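import Summits.ResolutionOfSingularities.ResolutionOfSingularities.Theorems.ValuativeLuAlphaPTorsorDiscreteRounds
import Summits.ResolutionOfSingularities.ResolutionOfSingularities.Theorems.ValuativeLuAlphaPTorsorDiscreteCleanBound
import Summits.ResolutionOfSingularities.ResolutionOfSingularities.Theorems.ValuativeLuAlphaPTorsorDiscreteFreeRegime

/-!
# Approximation rounds for `α_p`-torsors along a discrete rank-one valuation — ALL dimensions

Helper file for the branch `DiscreteAllDim` of the line `pfaff-line-log-final-forms` (crux
`Valuative.LuAlphaPTorsor`, item `stmt-ResolutionOfSingularities-0641`), registered sub-goal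
`discreteAllDim_rounds` (layer L4): the dimension-free form of the two-dimensional
`discreteSequence_rounds`.

Setting (inside one field `K'` of characteristic `p`): `R 0 → R 1 → ⋯` a sequence of quadratic
transforms along the valuation ring `O'` (of ANY dimension), `π` a generator of the discrete
rank-one value group lying in every `R i`, `i ≥ i₀`, with the free `π`-chart property
(`z / π ∈ R (i+1)` for every non-unit `z` of `R i`); a derivation `D₀` of `K'` killing `π` and a
chain `h i • D₀` of derivations preserving `R i`, scaled by `π` exactly at the TRANSVERSAL
stages (some non-unit of `R i` has a unit derivative); two schema facts taken as hypotheses —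
(sq) a non-unit `f` of `R i` either has a unit derivative under some derivation preserving
`R i`, or is a sum of products of two non-units ("`f ∈ 𝔪²`"), and (res) a unit `w` of `R i`
either has a unit derivative or is congruent to a `p`-th power modulo the non-units; finally
`a ∈ R i₀` is not a `p`-th power in any `R i` and `D₀ a ≠ 0`.

PROVED (`discreteAllDim_rounds`): at some stage `i ≥ i₀` there is `c ∈ R i` with either a
MONOGENIC exit datum `a - c ^ p = g ^ p * b`, `δ b` a unit for a derivation `δ` preserving `R i`,
or a TOROIDAL exit datum `a - c ^ p = π ^ N * w`, `w` a unit, `p ∤ N`.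

Proof. The inner loop (`descent`, strong induction on the value exponent `V` of the current
transform `f`, `a - c^p = π^E f`): at a stage where (sq) gives a unit derivative we EXIT if
`p ∣ E` (monogenic datum with `g = π^{E/p}`) and otherwise strip ONE `π` (`f ↦ f/π`,
`E ↦ E + 1`); at a stage where `f ∈ 𝔪²` we strip TWO (`f ↦ f/π²`, `E ↦ E + 2`); the chain scales
by `π^t`, `t ≤ 1`, per stage. Hence the number `τ` of scalings satisfies `τ ≤ V`, and `τ < V`
as soon as `p ∣ E` at the start and `V ≥ 1` (the first stage then strips two or exits). The
rounds (`discreteAllDim_rounds`, strong induction on the slack `s = ord_π v(h i D₀ w)` of a clean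
datum `a - c^p = π^{pn} w`, `w` a unit): (res) gives a unit derivative (exit) or
`f = w - e^p` non-unit, non-zero (`a` is not a `p`-th power); the inner loop from `E = pn`
exits or returns a unit `w' = f/π^V` with `τ < V`, whence `p ∤ pn + V` (toroidal exit) or a new
clean datum of slack `s' = s + τ - V < s`. All [folklore] bookkeeping over the hypotheses
(elementary; the two-dimensional case is Giraud / Cossart–Piltant folklore, the
dimension-free accounting is this line's).
-/

set_option linter.dupNamespace false

namespace Summit.ResolutionOfSingularities.ResolutionOfSingularities.Theorems.PfaffLine

open IsLocalRing Literature.AlgebraicGeometry.Resolution DiscreteRounds DiscreteFree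

/-- **Registered sub-goal `discreteAllDim_rounds`** (branch `DiscreteAllDim`, layer L4: the
approximation rounds in every dimension). See the module docstring for the setting; the
conclusion is a monogenic exit datum (`a - c^p = g^p b`, `δ b` a unit of `R i` for a field
derivation `δ` preserving `R i`) or a toroidal exit datum (`a - c^p = π^N w`, `w` a unit,
`p ∤ N`) at some stage `i ≥ i₀`. [folklore] -/
theorem discreteAllDim_rounds :
    ∀ (p : ℕ) [Fact p.Prime] (K' : Type) [Field K'] [CharP K' p] (O' : ValuationSubring K') (R : ℕ → Subring K') (π : K') (i₀ : ℕ) (D₀ : Derivation ℤ K' K') (h : ℕ → K') (a : K'), Literature.AlgebraicGeometry.Resolution.SubringDominates (R 0) O'.toSubring → (∀ i, Literature.AlgebraicGeometry.Resolution.IsQuadraticTransformAlong O' (R i) (R (i + 1))) → π ≠ 0 → O'.valuation π < 1 → (∀ z : K', z ≠ 0 → ∃ n : ℤ, O'.valuation z = O'.valuation π ^ n) → (∀ i : ℕ, i₀ ≤ i → π ∈ R i ∧ ∀ z : K', z ∈ R i → z⁻¹ ∉ R i → z / π ∈ R (i + 1)) → D₀ π = 0 → (∀ i : ℕ, i₀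 ≤ i → h i ≠ 0 ∧ h i ∈ R i ∧ (∀ z : K', z ∈ R i → h i * D₀ z ∈ R i) ∧ ((∃ z : K', z ∈ R i ∧ z⁻¹ ∉ R i ∧ h i * D₀ z ≠ 0 ∧ (h i * D₀ z)⁻¹ ∈ R i) → h (i + 1) = π * h i) ∧ ((¬ ∃ z : K', z ∈ R i ∧ z⁻¹ ∉ R i ∧ h i * D₀ z ≠ 0 ∧ (h i * D₀ z)⁻¹ ∈ R i) → h (i + 1) = h i)) → (∀ i : ℕ, i₀ ≤ i → ∀ f : K', f ∈ R i → O'.valuation f < 1 → (∃ δ : Derivation ℤ K' K', (∀ z : K', z ∈ R i → δ z ∈ R i) ∧ δ f ≠ 0 ∧ (δ f)⁻¹ ∈ R i) ∨ (∃ (m : ℕ) (b c : Fin m → K'), (∀ l, b l ∈ R i ∧ O'.valuation (b l) < 1 ∧ c l ∈ R i ∧ O'.valuation (c l) < 1) ∧ f = Finset.univ.sum fun l => b l * c l)) → (∀ i : ℕ, i₀ ≤ i → ∀ w : K', w ∈ R i → w⁻¹ ∈ R i → (∃ δ : Derivation ℤ K' K', (∀ z : K', z ∈ R i → δ z ∈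 R i) ∧ δ w ≠ 0 ∧ (δ w)⁻¹ ∈ R i) ∨ (∃ e : K', e ∈ R i ∧ O'.valuation (w - e ^ p) < 1)) → a ∈ R i₀ → (∀ i : ℕ, i₀ ≤ i → ∀ c : K', c ∈ R i → a ≠ c ^ p) → D₀ a ≠ 0 → ∃ i : ℕ, i₀ ≤ i ∧ ∃ c : K', c ∈ R i ∧ ((∃ (g b : K') (δ : Derivation ℤ K' K'), g ∈ R i ∧ b ∈ R i ∧ g ≠ 0 ∧ (∀ z : K', z ∈ R i → δ z ∈ R i) ∧ δ b ≠ 0 ∧ (δ b)⁻¹ ∈ R i ∧ a - c ^ p = g ^ p * b) ∨ (∃ (w : K') (N : ℕ), w ∈ R i ∧ w⁻¹ ∈ R i ∧ ¬ p ∣ N ∧ a - c ^ p = π ^ N * w)) := by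
  intro p _ K' _ _ O' R π i₀ D₀ h a hdom hstep hπ0 hπ1 hdisc hfree hDπ hchain hsq hres haR hap hDa
  classical
  have hp : p.Prime := Fact.out
  -- every member of the sequence is dominated by `O'`, and the sequence is monotone
  have hRO : ∀ n, SubringDominates (R n) O'.toSubring := fun n =>
    (sequence_dominates hdom hstep n).1
  have hmono : Monotone R := sequence_monotone hstep
  have hdiv : ∀ i, i₀ ≤ i → ∀ z : K', z ∈ R i → z⁻¹ ∉ R i → z / π ∈ R (i + 1) := fun i hi =>
    (hfree i hi).2
  have hπR : ∀ i, i₀ ≤ i → π ∈ R i := fun i hi => (hfree i hi).1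
  have hγ0 : O'.valuation π ≠ 0 := (Valuation.ne_zero_iff _).mpr hπ0
  have hγpos : 0 < O'.valuation π := pos_iff_ne_zero.mpr hγ0
  -- values `< 1` are `≤ v(π)`
  have hmax : ∀ z : K', O'.valuation z < 1 → O'.valuation z ≤ O'.valuation π := fun z hz =>
    valuation_le_of_lt_one hπ1 hγ0 hdisc hz
  -- the chain scales by `π ^ t`, `t ≤ 1`, at every stage
  have hscale : ∀ i, i₀ ≤ i → ∃ t : ℕ, t ≤ 1 ∧ h (i + 1) = π ^ t * h i := by
    intro i hi
    obtain ⟨-, -, -, htr, hntr⟩ := hchain i hi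
    by_cases hT : ∃ z : K', z ∈ R i ∧ z⁻¹ ∉ R i ∧ h i * D₀ z ≠ 0 ∧ (h i * D₀ z)⁻¹ ∈ R i
    · exact ⟨1, le_rfl, by rw [pow_one, htr hT]⟩
    · exact ⟨0, zero_le_one, by rw [pow_zero, one_mul, hntr hT]⟩
  -- dividing a zero-or-non-unit by `π` lands in the next ring
  have hdiv' : ∀ i, i₀ ≤ i → ∀ z : K', z ∈ R i → O'.valuation z < 1 → z / π ∈ R (i + 1) := by
    intro i hi z hz hvz
    by_cases hz0 : z = 0
    · rw [hz0, zero_div]; exact Subring.zero_mem _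
    · exact hdiv i hi z hz (inv_not_mem_subring_of_valuation_lt_one (hRO i).1 hz0 hvz)
  -- ### the inner loop (`descent`): strong induction on the value exponent `V` of `f`
  have descent : ∀ (V : ℕ) (i : ℕ) (c f : K') (E : ℕ), i₀ ≤ i → c ∈ R i → f ∈ R i → f ≠ 0 →
      O'.valuation f = O'.valuation π ^ V → a - c ^ p = π ^ E * f → h i * D₀ f ≠ 0 →
      (∃ j : ℕ, i ≤ j ∧ ∃ c : K', c ∈ R j ∧ ((∃ (g b : K') (δ : Derivation ℤ K' K'), g ∈ R j ∧
        b ∈ R j ∧ g ≠ 0 ∧ (∀ z : K', z ∈ R j → δ z ∈ R j) ∧ δ b ≠ 0 ∧ (δ b)⁻¹ ∈ R j ∧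
        a - c ^ p = g ^ p * b) ∨ (∃ (w : K') (N : ℕ), w ∈ R j ∧ w⁻¹ ∈ R j ∧ ¬ p ∣ N ∧
        a - c ^ p = π ^ N * w))) ∨
      (∃ (j τ : ℕ), i ≤ j ∧ h j = π ^ τ * h i ∧ τ ≤ V ∧ (p ∣ E → 1 ≤ V → τ < V) ∧
        f / π ^ V ∈ R j ∧ (f / π ^ V)⁻¹ ∈ R j) := by
    intro V
    induction V using Nat.strong_induction_on with
    | _ V ih =>
    intro i c f E hi hc hf hf0 hvf hcf hDf
    rcases Nat.eq_zero_or_pos V with rfl | hVpos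
    · -- `V = 0`: `f` is already a unit
      rw [pow_zero] at hvf
      refine Or.inr ⟨i, 0, le_rfl, by rw [pow_zero, one_mul], le_rfl,
        fun _ h1 => absurd h1 (by omega), ?_, ?_⟩
      · rw [pow_zero, div_one]; exact hf
      · rw [pow_zero, div_one]; exact inv_mem_subring_of_valuation_eq_one (hRO i) hf hvf
    -- `V ≥ 1`: `f` is a non-unit
    have hvf1 : O'.valuation f < 1 := by
      rw [hvf]; exact pow_lt_one₀ zero_le hπ1 (Nat.pos_iff_ne_zero.mp hVpos)
    have hi1 : i₀ ≤ i + 1 := hi.trans (Nat.le_succ i)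
    obtain ⟨t, ht1, hht⟩ := hscale i hi
    have hh1 := (hchain (i + 1) hi1).1
    rcases hsq i hi f hf hvf1 with ⟨δ, hδR, hδf, hδfi⟩ | ⟨m, b, c', hbc, hfsum⟩
    · -- (sq) gives a unit derivative
      by_cases hpE : p ∣ E
      · -- `p ∣ E`: monogenic EXIT at the stage `i`
        obtain ⟨n, rfl⟩ := hpE
        refine Or.inl ⟨i, le_rfl, c, hc, Or.inl ⟨π ^ n, f, δ, pow_mem (hπR i hi) n, hf,
          pow_ne_zero n hπ0, hδR, hδf, hδfi, ?_⟩⟩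
        rw [hcf, pow_mul']
      · -- `p ∤ E`: strip one `π`
        have hf1 : f / π ∈ R (i + 1) := hdiv' i hi f hf hvf1
        obtain ⟨V', rfl⟩ : ∃ V', V = V' + 1 := ⟨V - 1, by omega⟩
        have hvf' : O'.valuation (f / π) = O'.valuation π ^ V' := cleanBound_val_div hπ0 hvf
        have hcf' : a - c ^ p = π ^ (E + 1) * (f / π) := by
          rw [hcf, pow_succ, mul_assoc, mul_div_cancel₀ _ hπ0]
        have hDf' : h (i + 1) * D₀ (f / π) ≠ 0 := by
          refine mul_ne_zero hh1 ?_
          have e1 := cleanBound_deriv_div_pow D₀ hDπ f 1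
          rw [pow_one] at e1
          rw [e1]
          exact div_ne_zero (fun h0 => hDf (by rw [h0, mul_zero])) hπ0
        rcases ih V' (by omega) (i + 1) c (f / π) (E + 1) hi1 (hmono (Nat.le_succ i) hc) hf1
            (div_ne_zero hf0 hπ0) hvf' hcf' hDf' with hexit | ⟨j, τ', hij, hhj, hτ', -, hmem, hinv⟩
        · obtain ⟨j, hij, hrest⟩ := hexit
          exact Or.inl ⟨j, (Nat.le_succ i).trans hij, hrest⟩
        · refine Or.inr ⟨j, τ' + t, (Nat.le_succ i).trans hij, ?_, by omega,
            fun h1 _ => absurd h1 hpE, ?_, ?_⟩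
          · rw [hhj, hht, pow_add]; ring
          · rwa [pow_succ', ← div_div]
          · rwa [pow_succ', ← div_div]
    · -- (sq): `f ∈ 𝔪²`, strip two `π`'s
      -- `v(f) ≤ v(π)²`, so `V ≥ 2`
      have hvle : O'.valuation f ≤ O'.valuation π ^ 2 := by
        rw [hfsum]
        refine (Valuation.map_sum_le _ fun l _ => ?_)
        rw [Valuation.map_mul, pow_two]
        exact mul_le_mul' (hmax _ (hbc l).2.1) (hmax _ (hbc l).2.2.2)
      have hV2 : 2 ≤ V := by
        by_contra hlt
        have hV1 : V = 1 := by omega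
        rw [hvf, hV1, pow_one] at hvle
        have : O'.valuation π ^ 2 < O'.valuation π ^ 1 :=
          pow_lt_pow_right_of_lt_one₀ hγpos hπ1 (by norm_num)
        rw [pow_one] at this
        exact absurd hvle (not_le.mpr this)
      obtain ⟨V', rfl⟩ : ∃ V', V = V' + 2 := ⟨V - 2, by omega⟩
      have hf2 : f / π ^ 2 ∈ R (i + 1) := by
        have : f / π ^ 2 = Finset.univ.sum fun l => (b l / π) * (c' l / π) := by
          rw [hfsum, div_eq_mul_inv, Finset.sum_mul]
          refine Finset.sum_congr rfl fun l _ => ?_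
          rw [div_mul_div_comm, ← pow_two, div_eq_mul_inv]
        rw [this]
        refine Subring.sum_mem _ fun l _ => Subring.mul_mem _ ?_ ?_
        · exact hdiv' i hi _ (hbc l).1 (hbc l).2.1
        · exact hdiv' i hi _ (hbc l).2.2.1 (hbc l).2.2.2
      have hvf' : O'.valuation (f / π ^ 2) = O'.valuation π ^ V' := by
        rw [cleanBound_val_div_pow hπ0 hvf (by omega : 2 ≤ V' + 2)]
        congr 1
      have hcf' : a - c ^ p = π ^ (E + 2) * (f / π ^ 2) := by
        rw [hcf, pow_add, mul_assoc, mul_div_cancel₀ _ (pow_ne_zero 2 hπ0)]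
      have hDf' : h (i + 1) * D₀ (f / π ^ 2) ≠ 0 := by
        refine mul_ne_zero hh1 ?_
        rw [cleanBound_deriv_div_pow D₀ hDπ f 2]
        exact div_ne_zero (fun h0 => hDf (by rw [h0, mul_zero])) (pow_ne_zero 2 hπ0)
      rcases ih V' (by omega) (i + 1) c (f / π ^ 2) (E + 2) hi1 (hmono (Nat.le_succ i) hc) hf2
          (div_ne_zero hf0 (pow_ne_zero 2 hπ0)) hvf' hcf' hDf' with
        hexit | ⟨j, τ', hij, hhj, hτ', -, hmem, hinv⟩
      · obtain ⟨j, hij, hrest⟩ := hexit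
        exact Or.inl ⟨j, (Nat.le_succ i).trans hij, hrest⟩
      · refine Or.inr ⟨j, τ' + t, (Nat.le_succ i).trans hij, ?_, by omega, fun _ _ => by omega,
          ?_, ?_⟩
        · rw [hhj, hht, pow_add]; ring
        · rwa [pow_add, mul_comm, ← div_div]
        · rwa [pow_add, mul_comm, ← div_div]
  -- ### the rounds: strong induction on the slack `s` of a clean datum `(i, c, n, w)`
  have ha0 : a ≠ 0 := fun h0 => hap i₀ le_rfl 0 (Subring.zero_mem _) (by rw [zero_pow hp.ne_zero, h0])
  suffices key : ∀ (s : ℕ) (i : ℕ) (c w : K') (n : ℕ), i₀ ≤ i → c ∈ R i → w ∈ R i →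
      w⁻¹ ∈ R i → a - c ^ p = π ^ (p * n) * w →
      O'.valuation (h i * D₀ w) = O'.valuation π ^ s →
      ∃ i : ℕ, i₀ ≤ i ∧ ∃ c : K', c ∈ R i ∧ ((∃ (g b : K') (δ : Derivation ℤ K' K'), g ∈ R i ∧
        b ∈ R i ∧ g ≠ 0 ∧ (∀ z : K', z ∈ R i → δ z ∈ R i) ∧ δ b ≠ 0 ∧ (δ b)⁻¹ ∈ R i ∧
        a - c ^ p = g ^ p * b) ∨ (∃ (w : K') (N : ℕ), w ∈ R i ∧ w⁻¹ ∈ R i ∧ ¬ p ∣ N ∧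
        a - c ^ p = π ^ N * w)) by
    -- ### the initial datum: the inner loop from `a - 0^p = π^0 · a`
    have haO : a ∈ O' := (hRO i₀).1 haR
    obtain ⟨N, hN⟩ := exists_nat_of_valuation_le_one hπ0 hπ1 hdisc haO ha0
    have hca : a - 0 ^ p = π ^ 0 * a := by rw [zero_pow hp.ne_zero, sub_zero, pow_zero, one_mul]
    have hDa' : h i₀ * D₀ a ≠ 0 := mul_ne_zero (hchain i₀ le_rfl).1 hDa
    rcases descent N i₀ 0 a 0 le_rfl (Subring.zero_mem _) haR ha0 hN hca hDa' with
      ⟨j, hij, hrest⟩ | ⟨j, τ, hij, hhj, -, -, hw, hwi⟩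
    · exact ⟨j, hij, hrest⟩
    by_cases hpN : p ∣ N
    · obtain ⟨n, rfl⟩ := hpN
      have hcw : a - 0 ^ p = π ^ (p * n) * (a / π ^ (p * n)) := by
        rw [zero_pow hp.ne_zero, sub_zero, mul_div_cancel₀ _ (pow_ne_zero _ hπ0)]
      have hD := derivation_clean p D₀ hDπ hcw
      have hDw0 : D₀ (a / π ^ (p * n)) ≠ 0 := fun h0 => hDa (by rw [← hD, h0, mul_zero])
      have hcj := hchain j hij
      have hmem : h j * D₀ (a / π ^ (p * n)) ∈ O' := (hRO _).1 (hcj.2.2.1 _ hw)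
      obtain ⟨s, hs⟩ := exists_nat_of_valuation_le_one hπ0 hπ1 hdisc hmem (mul_ne_zero hcj.1 hDw0)
      exact key s j 0 (a / π ^ (p * n)) n hij (Subring.zero_mem _) hw hwi hcw hs
    · refine ⟨j, hij, 0, Subring.zero_mem _, Or.inr ⟨a / π ^ N, N, hw, hwi, hpN, ?_⟩⟩
      rw [zero_pow hp.ne_zero, sub_zero, mul_div_cancel₀ _ (pow_ne_zero N hπ0)]
  intro s
  induction s using Nat.strong_induction_on with
  | _ s ih =>
  intro i c w n hi hc hw hwi hcw hs
  have hci := hchain i hi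
  -- `w ≠ 0` and `D₀ w ≠ 0`, since `a` is not a `p`-th power and `D₀ a ≠ 0`
  have hw0 : w ≠ 0 := by
    rintro rfl
    rw [mul_zero, sub_eq_zero] at hcw
    exact hap i hi c hc hcw
  have hD := derivation_clean p D₀ hDπ hcw
  have hDw0 : D₀ w ≠ 0 := fun h0 => hDa (by rw [← hD, h0, mul_zero])
  -- (res): a unit derivative of `w` is a monogenic EXIT (`g = π^n`, `b = w`)
  rcases hres i hi w hw hwi with ⟨δ, hδR, hδw, hδwi⟩ | ⟨e, heR, hlt⟩
  · refine ⟨i, hi, c, hc, Or.inl ⟨π ^ n, w, δ, pow_mem (hπR i hi) n, hw, pow_ne_zero n hπ0, hδR,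
      hδw, hδwi, ?_⟩⟩
    rw [hcw, pow_mul']
  -- otherwise improve the approximation: `f := w - e ^ p` is a non-zero non-unit of `R i`
  have hfR : w - e ^ p ∈ R i := sub_mem hw (pow_mem heR p)
  have hce := sub_add_pow_char p e hcw
  have hf0 : w - e ^ p ≠ 0 := by
    intro hf0
    rw [hf0, mul_zero, sub_eq_zero] at hce
    exact hap i hi _ (add_mem hc (mul_mem (pow_mem (hπR i hi) n) heR)) hce
  obtain ⟨V, hV⟩ := exists_nat_of_valuation_le_one hπ0 hπ1 hdisc ((hRO i).1 hfR) hf0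
  have hV0 : 1 ≤ V := by
    by_contra hlt'
    have hV0 : V = 0 := by omega
    rw [hV, hV0, pow_zero] at hlt
    exact lt_irrefl _ hlt
  have hDf : D₀ (w - e ^ p) = D₀ w := by
    rw [map_sub, derivation_pow_char p D₀ e, sub_zero]
  have hDf0 : h i * D₀ (w - e ^ p) ≠ 0 := by rw [hDf]; exact mul_ne_zero hci.1 hDw0
  -- the inner loop from `E = p n`
  rcases descent V i (c + π ^ n * e) (w - e ^ p) (p * n) hi
      (add_mem hc (mul_mem (pow_mem (hπR i hi) n) heR)) hfR hf0 hV hce hDf0 with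
    ⟨j, hij, hrest⟩ | ⟨j, τ, hij, hhj, -, hstrict, hw', hw'i⟩
  · exact ⟨j, hi.trans hij, hrest⟩
  have hτV : τ < V := hstrict ⟨n, rfl⟩ hV0
  have hij₀ : i₀ ≤ j := hi.trans hij
  have hc' : c + π ^ n * e ∈ R j := hmono hij (add_mem hc (mul_mem (pow_mem (hπR i hi) n) heR))
  have hw'0 : (w - e ^ p) / π ^ V ≠ 0 := div_ne_zero hf0 (pow_ne_zero V hπ0)
  have hfe : π ^ V * ((w - e ^ p) / π ^ V) = w - e ^ p := mul_div_cancel₀ _ (pow_ne_zero V hπ0)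
  have hce' : a - (c + π ^ n * e) ^ p = π ^ (p * n + V) * ((w - e ^ p) / π ^ V) := by
    rw [hce, pow_add, mul_assoc, hfe]
  by_cases hpV : p ∣ V
  swap
  · -- toroidal EXIT: `p ∤ p n + V`
    refine ⟨j, hij₀, c + π ^ n * e, hc', Or.inr ⟨(w - e ^ p) / π ^ V, p * n + V, hw', hw'i,
      fun hd => hpV ?_, hce'⟩⟩
    exact (Nat.dvd_add_right ⟨n, rfl⟩).mp hd
  -- `p ∣ V`: a new clean datum with a smaller slack
  obtain ⟨V', rfl⟩ := hpV
  have hcw' : a - (c + π ^ n * e) ^ p = π ^ (p * (n + V')) * ((w - e ^ p) / π ^ (p * V')) := by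
    rw [mul_add]; exact hce'
  -- the new slack `s' = s + τ - p V' < s`
  have hcj := hchain j hij₀
  have hDw'0 : D₀ ((w - e ^ p) / π ^ (p * V')) ≠ 0 := by
    rw [cleanBound_deriv_div_pow D₀ hDπ _ (p * V'), hDf]
    exact div_ne_zero hDw0 (pow_ne_zero _ hπ0)
  have hmem' : h j * D₀ ((w - e ^ p) / π ^ (p * V')) ∈ O' := (hRO _).1 (hcj.2.2.1 _ hw')
  obtain ⟨s', hs'⟩ := exists_nat_of_valuation_le_one hπ0 hπ1 hdisc hmem' (mul_ne_zero hcj.1 hDw'0)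
  have hDf' : D₀ (w - e ^ p) = π ^ (p * V') * D₀ ((w - e ^ p) / π ^ (p * V')) := by
    conv_lhs => rw [← hfe]
    rw [D₀.leibniz, derivation_pow_eq_zero D₀ hDπ, smul_zero, add_zero, smul_eq_mul]
  have hX : π ^ (p * V') * (h j * D₀ ((w - e ^ p) / π ^ (p * V'))) = π ^ τ * (h i * D₀ w) := by
    rw [hhj, ← hDf, hDf']; ring
  have hvX : O'.valuation π ^ (p * V' + s') = O'.valuation π ^ (τ + s) := by
    rw [pow_add, ← hs', ← map_pow, ← map_mul, hX, map_mul, map_pow, hs, ← pow_add]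
  have hss : p * V' + s' = τ + s := cleanBound_eq_of_pow_val_eq hπ0 hπ1 hvX
  exact ih s' (by omega) j (c + π ^ n * e) ((w - e ^ p) / π ^ (p * V')) (n + V') hij₀ hc' hw'
    hw'i hcw' hs'

end Summit.ResolutionOfSingularities.ResolutionOfSingularities.Theorems.PfaffLine
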